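import Summits.BirchSwinnertonDyer.Rank1Residual.AdditivePotMult.PotMultRankOneKatoCertificate
import Summits.BirchSwinnertonDyer.Rank1Residual.AdditivePotMult.PotMultChiBranchPrimePrep
import Summits.BirchSwinnertonDyer.Rank1Residual.Additive.SemistableTwistAnalyticOdd
import Summits.BirchSwinnertonDyer.Rank1Residual.Additive.ChiBranchLowerTransportPotMult
import Summits.BirchSwinnertonDyer.Rank1Residual.Additive.CycLeadingTermDvdConverse
import Summits.BirchSwinnertonDyer.Rank1Residual.Additive.CycLeadingTermDvdIff
import Summits.BirchSwinnertonDyer.Rank1Residual.GaloisImage.JWitnessTowerSurjectivity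
import Literature.NumberTheory.EllipticCurves.LeadingTermPPartProofs
import HarnessLib

/-!
# Route `AdditiveBranchIMC` (rung K1), crux `MultLower` (item `stmt-BirchSwinnertonDyer-19359`):
# the rank-0 Λ-adic upgrade on cell (M), ODD branch (`p ≡ 3 (mod 4)`, `p = 3` included)

Cell `bsd-addord`, seat `bsd-addord-k1-c4` (gen 2). Sibling of `AdditiveBranchIMCMultLowerLambdaAdic.lean`
(even branch): same statements and proofs with MINUS modular symbols, the imaginary period
`ϖ⁻·|Ω⁻(V)| = Ω⁻_f`, the minus one-term branch series `L⁻_p(f, ±1, ω^{(p−1)/2}, T)` and the odd Birch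
identity (`entireLFunction_one_eq_of_twist_neg`, no Pal input). HONEST FRAMING as there: named-fact
binders `hK` (Kato 17.4 (3) half-eigen reading), `hmod`, `hDel`, `hDelX`, `hGZK`, `hmodD`; the LOWER input
stays displayed; nothing asserted about any curve; cell (M) stays CONSTRUCTION-shaped; nothing booked.
THEOREMS ONLY.

* §1 `charIdeal_eq_span_kato_of_chiBranchLowerLeadingTermOdd_rankZero_mult`: `T = 0` odd input + Kato ⟹
  `char_Λ X(E/ℚ_∞) = (g_K)`, `ι g_K = u·ϖ⁻·B⁻`, at every tower-surjective multiplicative twist datum.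
* §2 consequences: the Λ-adic odd lower conclusion per datum; `MissingLowerBoundAt ↔
  ChiBranchLowerLeadingTermOddAt` on X4(M), `p ≥ 5`; the upgrade from `MissingLowerBoundAt` itself.

References: K. Kato, Astérisque 295 (2004) Thm. 17.4 (3) [Kato2004Asterisque]; C. Wuthrich, Doc. Math.
19 (2014) §3, Cor. 19 [Wuthrich2014]; Mazur–Tate–Teitelbaum, Invent. Math. 84 (1986) §I.13–I.14
[MazurTateTeitelbaum1986Invent]; D. Delbourgo, Compositio Math. 113 (1998) Prop. 4 [Delbourgo1998];
L. C. Washington, Introduction to Cyclotomic Fields, §13.2 [Washington1997].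
-/

set_option autoImplicit false
set_option linter.dupNamespace false

noncomputable section

open scoped Classical MatrixGroups ModularForm

open CongruenceSubgroup WeierstrassCurve NumberField IsDedekindDomain Rat.HeightOneSpectrum
  Literature.NumberTheory.EllipticCurves
  Literature.NumberTheory.EllipticCurves.ModularForms
  Literature.NumberTheory.EllipticCurves.Rank1Residual
  Literature.NumberTheory.EllipticCurves.Rank1Residual.Typed
  Literature.NumberTheory.GaloisRepresentations

namespace Summit.BirchSwinnertonDyer.BirchSwinnertonDyer.Theorems.AdditiveBranchIMCMultLowerLambdaAdic

open Summit.BirchSwinnertonDyer.Rank1Residual.Additive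
open Summit.BirchSwinnertonDyer.Rank1Residual.AdditivePotMult

variable {W : WeierstrassCurve ℚ} [W.IsElliptic] [W.IsGloballyMinimal] {p : ℕ} [hp : Fact p.Prime]

/-! ## §1 Odd branch (`p ≡ 3 (mod 4)`, `p = 3` included): the same upgrade with minus symbols and
the imaginary period -/

/-- **The full main conjecture on the `ω^{(p−1)/2}`-branch from the `T = 0` lower input, analytic rank
`0`, cell (M), ODD branch** (per datum). `W = E` globally minimal, additive at `p ≡ 3 (mod 4)`,
`ord_{s=1} L(E,s) = 0`, `ρ_{E,pⁿ}` onto for all `n`; `(V, f, ϖ⁻)` a MULTIPLICATIVE twist datum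
(`C • V^{(−p)} = W`, `ϖ⁻·|Ω⁻(V)| = Ω⁻_f`), `D` a dual datum at a cyclotomic `κ/γ`. IF
`ChiBranchLowerLeadingTermOddAt W p` holds, then `char_Λ X(E/ℚ_∞) = (g_K)` with
`ι g_K = u·ϖ⁻·L⁻_p(f, a_p, ω^{(p−1)/2}, T)`, `u ∈ ℤ_p^×`. Inputs by name: Kato's half-eigen reading `hK`,
modularity `hmod` (odd Birch: `L(E,1) = ±ϖ⁻ S⁻ Ω_E/(|u| c_∞)`, so `ϖ⁻ S⁻ ≠ 0` in rank `0`),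
principality of `char_Λ`. [cite: Kato2004Asterisque, Thm. 17.4 (3) (p. 273)]
[cite: Wuthrich2014, §3 (p. 390), Cor. 19 (p. 398)] [cite: MazurTateTeitelbaum1986Invent, §I.14]
[cite: Washington1997, §13.2] -/
theorem charIdeal_eq_span_kato_of_chiBranchLowerLeadingTermOdd_rankZero_mult
    (hK : Wuthrich2014.kato_halfEigenCharIdeal_dvd_cyclotomicPrime_of_surjective)
    (hmod : hasEntireLFunction_rat)
    (hadd : Addv W p) (hr : W.analyticRank = 0)
    (htower : ∀ n : ℕ, W.HasSurjectiveModNGaloisRep (p ^ n : ℕ))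
    (hLow : ChiBranchLowerLeadingTermOddAt W p)
    (V : WeierstrassCurve ℚ) [V.IsElliptic] [V.IsGloballyMinimal]
    {κ : ZpExtension ℚ p} {γ : Field.absoluteGaloisGroup ℚ} {N : ℕ} [NeZero N]
    {f : CuspForm (Gamma0 N) 2} (hp3 : p % 4 = 3)
    (hCW : ∃ C : VariableChange ℚ, C • V.quadraticTwist (-(p : ℚ)) = W) (hV : Mult V p)
    (hκ : κ.IsCyclotomic) (hγ : κ.IsTopGenerator γ) (hcv : IsCyclotomicVariable p γ)
    (hf : IsNewformOf V f) (D : W.SelmerDualData κ γ) (ϖ : ℚ)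
    (hϖ : (ϖ : ℝ) * V.imaginaryPeriodRat = minusPeriod f) :
    ∃ (B : PowerSeries ℚ_[p]) (e : ℤ_[p]ˣ),
      ((V.HasSplitMultiplicativeReductionAtPrime p ∧
          B = padicLFunctionMinusBranchMult f (1 : ℚ_[p]) (p / 2)) ∨
        (¬ V.HasSplitMultiplicativeReductionAtPrime p ∧
          B = padicLFunctionMinusBranchMult f (-1 : ℚ_[p]) (p / 2))) ∧
      PowerSeries.constantCoeff B = ((e : ℤ_[p]) : ℚ_[p]) * (legendreMinusSymbolSum f p : ℚ_[p]) ∧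
      ∃ gK ∈ D.charIdeal, ∃ u : ℤ_[p]ˣ, D.charIdeal = Ideal.span {gK} ∧
        iwasawaToPowerSeries p gK = PowerSeries.C (((u : ℤ_[p]) : ℚ_[p]) * (ϖ : ℚ_[p])) * B := by
  have hp2 : p ≠ 2 := by rintro rfl; norm_num at hp3
  have hpne : (-(p : ℚ)) ≠ 0 := neg_ne_zero.mpr (Nat.cast_ne_zero.mpr hp.out.ne_zero)
  have hodd : ¬ Even (p / 2) := by rw [Nat.not_even_iff_odd]; exact ⟨p / 4, by omega⟩
  have hodd' : Odd (p / 2) := ⟨p / 4, by omega⟩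
  -- the tower of `E` is the tower of `V`
  have hsurjV : ∀ n : ℕ, V.HasSurjectiveModNGaloisRep (p ^ n : ℕ) := fun n ↦
    (Summit.BirchSwinnertonDyer.Rank1Residual.GaloisImage.hasSurjectiveModNGaloisRep_pow_iff_of_model_twist
      V p hpne hCW n).mp (htower n)
  -- the branch series of the reduction type, with its constant term
  obtain ⟨B, e, hdisj, hB0⟩ := exists_halfBranchMult_odd p hp2 hodd hV hf
  obtain ⟨C, hC⟩ := hCW
  have hC' : C • V.quadraticTwist ((-1 : ℚ) ^ (p / 2) * p) = W := by
    rw [Odd.neg_one_pow hodd', neg_one_mul]; exact hC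
  -- Kato's element, Λ-adically, on the branch
  have hϖ' : (if Even (p / 2) then (ϖ : ℝ) * V.realPeriodRat = plusPeriod f
      else (ϖ : ℝ) * V.imaginaryPeriodRat = minusPeriod f) := by
    rw [if_neg hodd]; exact hϖ
  obtain ⟨-, gK, hgK, u, hιgK⟩ :=
    isTorsion_and_exists_iota_eq_of_katoHalf hK hp2 V C hC' hsurjV hκ hγ hcv hf D B hdisj ϖ hϖ'
  have hnotord : ¬ IsOrdinaryAt V p := fun h ↦
    (WeierstrassCurve.HasGoodReduction.not_hasMultiplicativeReduction (R := ℤ_[p]) h.1) hV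
  have hBshape : (V.HasSplitMultiplicativeReductionAtPrime p ∧
        B = padicLFunctionMinusBranchMult f (1 : ℚ_[p]) (p / 2)) ∨
      (¬ V.HasSplitMultiplicativeReductionAtPrime p ∧
        B = padicLFunctionMinusBranchMult f (-1 : ℚ_[p]) (p / 2)) := by
    rcases hdisj with ⟨hord, -⟩ | ⟨hs, hB⟩ | ⟨-, hns, hB⟩
    · exact absurd hord hnotord
    · exact Or.inl ⟨hs, by rw [hB, if_neg hodd]⟩
    · exact Or.inr ⟨hns, by rw [hB, if_neg hodd]⟩
  refine ⟨B, e, hBshape, hB0, ?_⟩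
  -- a generator `f₁` of `char X`
  haveI : (Module.charIdeal (IwasawaAlgebra p) D.X).IsPrincipal := charIdeal_isPrincipal_holds p D.X
  obtain ⟨f₁, hf₁⟩ := Submodule.IsPrincipal.principal (Module.charIdeal (IwasawaAlgebra p) D.X)
  have hf₁mem : f₁ ∈ D.charIdeal := by
    change f₁ ∈ Module.charIdeal (IwasawaAlgebra p) D.X
    rw [hf₁]
    exact Ideal.mem_span_singleton_self f₁
  -- the `T = 0` lower input at `f₁`: `f₁(0) = c·ϖ⁻·S⁻`
  obtain ⟨c, hc⟩ := hLow V hp3 ⟨C, hC⟩ (Or.inr hV) hκ hγ hcv hf D ϖ hϖ f₁ hf₁mem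
  -- `gK = h · f₁`
  have hgK' : gK ∈ Ideal.span {f₁} := by
    change gK ∈ Module.charIdeal (IwasawaAlgebra p) D.X at hgK
    rwa [hf₁] at hgK
  obtain ⟨h, hh⟩ := Ideal.mem_span_singleton'.mp hgK'
  -- constant terms
  have h0 := congrArg PowerSeries.constantCoeff hιgK
  rw [constantCoeff_iwasawaToPowerSeries, map_mul, PowerSeries.constantCoeff_C, hB0] at h0
  have hprod : ((PowerSeries.constantCoeff gK : ℤ_[p]) : ℚ_[p]) =
      ((PowerSeries.constantCoeff h : ℤ_[p]) : ℚ_[p]) *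
        ((PowerSeries.constantCoeff f₁ : ℤ_[p]) : ℚ_[p]) := by
    rw [← hh, map_mul, PadicInt.coe_mul]
  -- `ϖ⁻ S⁻ ≠ 0` in rank `0` (odd Birch)
  have hϖS : (ϖ : ℚ_[p]) * (legendreMinusSymbolSum f p : ℚ_[p]) ≠ 0 := by
    obtain ⟨ε, -, hL⟩ := entireLFunction_one_eq_of_twist_neg p hmod hp3 V W C hC hadd hf ϖ hϖ
    have hL0 : W.entireLFunction 1 ≠ 0 := (W.analyticRank_eq_zero_iff_holds (hmod W)).mp hr
    have hq : (ϖ * legendreMinusSymbolSum f p : ℚ) ≠ 0 := by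
      intro hz
      apply hL0
      rw [hL, hz, mul_zero, zero_div, Rat.cast_zero, zero_mul]
    have hq' : ((ϖ * legendreMinusSymbolSum f p : ℚ) : ℚ_[p]) ≠ 0 := by exact_mod_cast hq
    simpa [Rat.cast_mul] using hq'
  -- hence `h(0)·c = u·e`, a unit of `ℤ_p`
  have hkey : ((PowerSeries.constantCoeff h : ℤ_[p]) : ℚ_[p]) * (c : ℚ_[p]) =
      ((u : ℤ_[p]) : ℚ_[p]) * ((e : ℤ_[p]) : ℚ_[p]) := by
    have e1 : ((PowerSeries.constantCoeff h : ℤ_[p]) : ℚ_[p]) * (c : ℚ_[p]) *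
        ((ϖ : ℚ_[p]) * (legendreMinusSymbolSum f p : ℚ_[p])) =
        ((u : ℤ_[p]) : ℚ_[p]) * ((e : ℤ_[p]) : ℚ_[p]) *
          ((ϖ : ℚ_[p]) * (legendreMinusSymbolSum f p : ℚ_[p])) := by
      have e2 := h0
      rw [hprod, hc] at e2
      linear_combination e2
    exact mul_right_cancel₀ hϖS e1
  have hunitZ : IsUnit (PowerSeries.constantCoeff h * c) := by
    have hcoe : (((PowerSeries.constantCoeff h * c : ℤ_[p])) : ℚ_[p]) =
        (((u * e : ℤ_[p]ˣ) : ℤ_[p]) : ℚ_[p]) := by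
      rw [PadicInt.coe_mul, hkey, Units.val_mul, PadicInt.coe_mul]
    have heq : PowerSeries.constantCoeff h * c = ((u * e : ℤ_[p]ˣ) : ℤ_[p]) := PadicInt.ext hcoe
    rw [heq]
    exact Units.isUnit _
  have hunit_h : IsUnit h :=
    (PowerSeries.isUnit_iff_constantCoeff (φ := h)).mpr (isUnit_of_mul_isUnit_left hunitZ)
  have hspan : Ideal.span {f₁} = Ideal.span ({gK} : Set (IwasawaAlgebra p)) := by
    rw [← hh]
    exact (Ideal.span_singleton_mul_left_unit hunit_h f₁).symm
  refine ⟨gK, hgK, u, ?_, hιgK⟩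
  change Module.charIdeal (IwasawaAlgebra p) D.X = _
  rw [hf₁]
  exact hspan

/-! ## §2 Consequences on the odd branch -/

/-- **Odd-branch twin** (`p ≡ 3 (mod 4)`): the Λ-adic lower conclusion `ι g = ι h · (ϖ⁻·B⁻)` at every
tower-surjective multiplicative twist datum, given `ChiBranchLowerLeadingTermOddAt W p` in rank `0`.
[cite: Kato2004Asterisque, Thm. 17.4 (3) (p. 273)] [cite: MazurTateTeitelbaum1986Invent, §I.14] -/
theorem branchLowerDivisibilityOdd_of_chiBranchLowerLeadingTermOdd_rankZero_mult_towerSurj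
    (hK : Wuthrich2014.kato_halfEigenCharIdeal_dvd_cyclotomicPrime_of_surjective)
    (hmod : hasEntireLFunction_rat)
    (hadd : Addv W p) (hr : W.analyticRank = 0)
    (htower : ∀ n : ℕ, W.HasSurjectiveModNGaloisRep (p ^ n : ℕ))
    (hLow : ChiBranchLowerLeadingTermOddAt W p)
    (V : WeierstrassCurve ℚ) [V.IsElliptic] [V.IsGloballyMinimal]
    {κ : ZpExtension ℚ p} {γ : Field.absoluteGaloisGroup ℚ} {N : ℕ} [NeZero N]
    {f : CuspForm (Gamma0 N) 2} (hp3 : p % 4 = 3)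
    (hCW : ∃ C : VariableChange ℚ, C • V.quadraticTwist (-(p : ℚ)) = W) (hV : Mult V p)
    (hκ : κ.IsCyclotomic) (hγ : κ.IsTopGenerator γ) (hcv : IsCyclotomicVariable p γ)
    (hf : IsNewformOf V f) (D : W.SelmerDualData κ γ) (ϖ : ℚ)
    (hϖ : (ϖ : ℝ) * V.imaginaryPeriodRat = minusPeriod f) :
    ∃ B : PowerSeries ℚ_[p],
      ((V.HasSplitMultiplicativeReductionAtPrime p ∧
          B = padicLFunctionMinusBranchMult f (1 : ℚ_[p]) (p / 2)) ∨
        (¬ V.HasSplitMultiplicativeReductionAtPrime p ∧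
          B = padicLFunctionMinusBranchMult f (-1 : ℚ_[p]) (p / 2))) ∧
      ∀ g ∈ D.charIdeal, ∃ h : IwasawaAlgebra p,
        iwasawaToPowerSeries p g = iwasawaToPowerSeries p h * (PowerSeries.C ((ϖ : ℚ) : ℚ_[p]) * B) := by
  obtain ⟨B, e, hBshape, -, gK, -, u, hchar, hιgK⟩ :=
    charIdeal_eq_span_kato_of_chiBranchLowerLeadingTermOdd_rankZero_mult hK hmod hadd hr htower hLow V
      hp3 hCW hV hκ hγ hcv hf D ϖ hϖ
  refine ⟨B, hBshape, fun g hg ↦ ?_⟩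
  rw [hchar] at hg
  obtain ⟨k, hk⟩ := Ideal.mem_span_singleton'.mp hg
  refine ⟨k * PowerSeries.C (u : ℤ_[p]), ?_⟩
  have hιC : iwasawaToPowerSeries p (PowerSeries.C (u : ℤ_[p])) =
      PowerSeries.C (((u : ℤ_[p]) : ℤ_[p]) : ℚ_[p]) := by
    rw [iwasawaToPowerSeries, PowerSeries.map_C]
    rfl
  rw [← hk]
  simp only [map_mul, hιgK, hιC]
  ring

/-- **Odd-parity twin**: X4(M), `r_an = 0`, `p ≥ 5`, `p ≡ 3 (mod 4)`:
`MissingLowerBoundAt W p ↔ ChiBranchLowerLeadingTermOddAt W p`. Bookkeeping over the tree's iffs.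
[cite: Delbourgo1998, Prop. 4 (p. 144), §2.2 Lemma (ii) (p. 139)] [cite: Miller2011LMS, Def. 1.1] -/
theorem missingLowerBoundAt_iff_chiBranchLowerLeadingTermOddAt_classX4M_rankZero
    (hDel : Delbourgo1998.prop4_rankZero_pow_dvd_constantCoeff)
    (hDelX : Delbourgo1998.prop4_rankZero_constantCoeff_eq_unit_mul_of_potMult)
    (hGZK : rank_eq_analyticRank_of_analyticRank_le_one) (hmod : hasEntireLFunction_rat)
    (hmodD : nonempty_modularParametrizationData)
    (hX : ClassX4M W p) (hp5 : 5 ≤ p) (hp3 : p % 4 = 3) (hr : W.analyticRank = 0) :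
    MissingLowerBoundAt W p ↔ ChiBranchLowerLeadingTermOddAt W p :=
  (missingLowerBoundAt_iff_cycLeadingTermDvdAt_of_potMult_of_five_le W p hDel hDelX hGZK hmod hp5 hX.2.1
      hX.2.2 hr).trans
    ((cycLeadingTermDvdAt_iff_cycLowerLeadingTermAt W p).trans
      (ClassX4M.cycLowerLeadingTermAt_iff_chiBranchLowerOdd hmod hmodD hX hp3))

/-- **From the crux's own conclusion, odd branch** (`p ≡ 3 (mod 4)`, `p ≥ 5` — so `p ≥ 7`): the lower
half `MissingLowerBoundAt W p` on a tower-surjective pair of X4(M) in rank `0` gives the full branch main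
conjecture at every multiplicative twist datum (minus branch, imaginary period).
[cite: Kato2004Asterisque, Thm. 17.4 (3) (p. 273)] [cite: Delbourgo1998, Prop. 4 (p. 144)]
[cite: Miller2011LMS, Def. 1.1] -/
theorem charIdeal_eq_span_kato_of_missingLowerBoundAt_rankZero_mult_odd
    (hK : Wuthrich2014.kato_halfEigenCharIdeal_dvd_cyclotomicPrime_of_surjective)
    (hDel : Delbourgo1998.prop4_rankZero_pow_dvd_constantCoeff)
    (hDelX : Delbourgo1998.prop4_rankZero_constantCoeff_eq_unit_mul_of_potMult)
    (hGZK : rank_eq_analyticRank_of_analyticRank_le_one) (hmod : hasEntireLFunction_rat)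
    (hmodD : nonempty_modularParametrizationData)
    (hX : ClassX4M W p) (hp5 : 5 ≤ p) (hp3 : p % 4 = 3) (hr : W.analyticRank = 0)
    (htower : ∀ n : ℕ, W.HasSurjectiveModNGaloisRep (p ^ n : ℕ))
    (hlow : MissingLowerBoundAt W p)
    (V : WeierstrassCurve ℚ) [V.IsElliptic] [V.IsGloballyMinimal]
    {κ : ZpExtension ℚ p} {γ : Field.absoluteGaloisGroup ℚ} {N : ℕ} [NeZero N]
    {f : CuspForm (Gamma0 N) 2}
    (hCW : ∃ C : VariableChange ℚ, C • V.quadraticTwist (-(p : ℚ)) = W) (hV : Mult V p)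
    (hκ : κ.IsCyclotomic) (hγ : κ.IsTopGenerator γ) (hcv : IsCyclotomicVariable p γ)
    (hf : IsNewformOf V f) (D : W.SelmerDualData κ γ) (ϖ : ℚ)
    (hϖ : (ϖ : ℝ) * V.imaginaryPeriodRat = minusPeriod f) :
    ∃ (B : PowerSeries ℚ_[p]) (e : ℤ_[p]ˣ),
      ((V.HasSplitMultiplicativeReductionAtPrime p ∧
          B = padicLFunctionMinusBranchMult f (1 : ℚ_[p]) (p / 2)) ∨
        (¬ V.HasSplitMultiplicativeReductionAtPrime p ∧
          B = padicLFunctionMinusBranchMult f (-1 : ℚ_[p]) (p / 2))) ∧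
      PowerSeries.constantCoeff B = ((e : ℤ_[p]) : ℚ_[p]) * (legendreMinusSymbolSum f p : ℚ_[p]) ∧
      ∃ gK ∈ D.charIdeal, ∃ u : ℤ_[p]ˣ, D.charIdeal = Ideal.span {gK} ∧
        iwasawaToPowerSeries p gK = PowerSeries.C (((u : ℤ_[p]) : ℚ_[p]) * (ϖ : ℚ_[p])) * B :=
  charIdeal_eq_span_kato_of_chiBranchLowerLeadingTermOdd_rankZero_mult hK hmod hX.2.1 hr htower
    ((missingLowerBoundAt_iff_chiBranchLowerLeadingTermOddAt_classX4M_rankZero hDel hDelX hGZK hmod hmodD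
      hX hp5 hp3 hr).mp hlow) V hp3 hCW hV hκ hγ hcv hf D ϖ hϖ

end Summit.BirchSwinnertonDyer.BirchSwinnertonDyer.Theorems.AdditiveBranchIMCMultLowerLambdaAdic

end
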